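import Summits.Schanuel.Schanuel.Theorems.RootDecomp1BProductCell04

/-!
# RootDecomp1BProductCell — lens 4, generation 46 «PRODUCT CELL: TWO INDEPENDENT LIOUVILLE COORDINATES VIA THE QUANTITATIVE STOREY-ONE CELL» (CLAIM L2339, PRICE + CHECKLIST B-g46 L2340, NODE L2399 / REQUEST L2400, critic VERDICT L2407: CLEARED — THEOREM ×1 (K1 twoRadical_lower, the composable quantitative engine) + ONE CELL «RATE-MATCHED PRODUCT 𝒜_W × ℬ_W» (K2 algebraicIndependent_product + cells); RULE B-R33; PORT GO) — continuation (RootDecomp1BProductCell05): §5 the product kernel K2 algebraicIndependent_product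

(lens-4 g46 HOME kernel K = HOME/decomp-schanuel-lens-4/g46/ProductCell.lean d6cd9943…, 1931 l, ONE import …RootDecomp1BTwoRadical05; P/C + NODE-g46.md 601195d2…. Port by census-1 gen 20 as `RootDecomp1BProductCell01–08` from the census CAP EDITION ProductCell.capped.lean (K2 `algebraicIndependent_product` is ONE 398-line declaration block > the 400-line file cap: its step (3) «thrP(N) ≤ exp(c_T q⁴)» — four exponential bounds, context-free — is extracted as the public lemma `thr_le_exp_quartic` in §3c with the local abbreviations passed as variables and the defining equation of c_T as a hypothesis; K2's STATEMENT byte-identical, all 87 K decl signatures identical, +1 decl; farm rc 0 · 0/0/0 · axioms std on K2): 01 = §1 Lipschitz (`FrelC`, `lam`, `lipschitz_Frel₂_explicit`) + §2 root avoidance (`fibreSum_ne_zero`); 02 = §3 K1 `thr`, `bigTheta`, `thrP`, **`twoRadical_lower`**; 03 = §3b outer upper half (`norm_normForm_le`, `normForm_len_le`); 04 = §3c `thr_le`, `thr_le_exp_quartic` (cap lemma) + §4 classes `UltraLiouvilleSW` / `TowerLiouville` («[class] definition» tags) + `thr_nonneg` + §5 prelude `thetaS`; 05 = §5 K2 **`algebraicIndependent_product`**;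 06 = §6 law `sw`, members `ultraLiouvilleSW_rhoU` (tree rhoU), `gT`/`vT`/`tTerm`/`rhoT`/`tNum`/`tRat`, `towerLiouville_rhoT`; 07 = §7 cells `algebraicIndependent_eight_of_pos`, `eight_le_polarDeg_one_pair`, `six_le_polarDeg_one_pair`, `schanuel_body_one_pair`, `six_le_polarDeg_pair`, `four_le_polarDeg_pair`, `schanuel_body_pair`, named pair (ρ_U, ρ_T) hyp-free; 08 = §8 `E₅`, `thrP_le_exp`, `transcMeasure_thetaS`, `transcMeasure_rhoU`. PORT EDITS (VERDICT L2407 (a)–(d) + the cap edition): linter option dropped; 26 one-line docstrings added; class tags in the census wording; scoped heartbeats kept `… in` (1600000 ×2, 800000 ×1 as in K); per-part private helper copies; statements and proofs otherwise verbatim (no renames). `--supports stmt-Schanuel-24622`; no census credit carried; rung 0 — nothing here proves Schanuel; no ∀-item moves.)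
-/

noncomputable section
open Complex
namespace Summit.Schanuel.Schanuel.Theorems.RootDecomp1BProductCell
open MvPolynomial
open Summit.Schanuel.Schanuel.Theorems.RootDecomp1KHyper (mvlen mvlen_nonneg one_le_mvlen abs_coeff_le_mvlen)
open RootDecomp1BRadicalDescent (resFin DExpMeasure UltraLiouville exists_int_relation norm_mvaeval_le_mvlen
  totalDegree_det_le mvlen_det_le adjugate_bounds)
open RootDecomp1BTwoRadical (sX₃ sX₃_apply eq_of_parts₃ Cf₂ Frel₂ Frel₂_eq_aeval radMat₂ det_radMat₂_ne_zero
  det_eq_eigen_mul₂ eigen_eq_Frel₂ mvlen_radMat₂_le totalDegree_radMat₂_le mvlen_Cf₂_le twoRadical_clash)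
variable {n : ℕ}

section Product

/-- `a + exp b ≤ exp (a + b)` for `a, b ≥ 0`. -/
private theorem add_exp_le_exp_add {a b : ℝ} (ha : 0 ≤ a) (hb : 0 ≤ b) : a + Real.exp b ≤ Real.exp (a + b) := by
  rw [Real.exp_add]
  have h1 : a + 1 ≤ Real.exp a := Real.add_one_le_exp a
  have h2 : 1 ≤ Real.exp b := Real.one_le_exp hb
  nlinarith [Real.exp_pos a, Real.exp_pos b]

set_option maxHeartbeats 1600000 in

set_option maxHeartbeats 1600000 in
/-- **PRODUCT KERNEL (lens-4 g46).** Let `θ₀ ∈ ℂⁿ` carry the degree-uniform measure (exponent `A₀`),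
`e^{y₀} = θ₀_{i₀}`, `e^{y₁} = θ₀_{i₁}` (`i₀ ≠ i₁`), `W` a monotone waiting law, `σ > 0` ultra-Liouville with
`W`-short waits and `ρ > 0` out-waiting `W`. Then the `n + 6` numbers
`(e^{ρ y₀}, e^{ρ y₁}, ρ, e^{σ y₀}, e^{σ y₁}, σ, θ₀)` are algebraically independent over `ℚ`.
PROOF. The two-radical descent of g44b over the TRANSCENDENTAL base `θ_σ` (formal algebra `radMat₂`,
`det_radMat₂_ne_zero`, `det_eq_eigen_mul₂`, `eigen_eq_Frel₂` BY TREE NAME; radicals `e^{y₀/q}, e^{y₁/q}` at a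
ρ-scale `q = den r`): UPPER `‖N(θ_σ)‖ ≤ (Kl+1)·exp(cU q⁴)·|ρ − r|` (`norm_normForm_le`); LOWER from the
QUANTITATIVE storey-one cell `twoRadical_lower` applied to the norm form `N ≠ 0` at a σ-scale
`den r_σ ∈ [Q, W Q]`, `Q ≥ thrP(N)` supplied by the short waits, `Q ≤ ⌈exp(q^m)⌉`; ρ's rate
`exp(−(q^m + exp(((W⌈exp q^m⌉)²)^m)))` beats the lower bound `exp(−exp(((den r_σ)²)^{A₀+2}))`. The ONLY
interaction of σ and ρ is this comparison of ρ's rate with the OUTPUT of σ's cell (no common denominator). -/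
theorem algebraicIndependent_product {θ₀ : Fin n → ℂ} {A₀ : ℕ}
    (hA₀ : ∀ Q : MvPolynomial (Fin n) ℤ, Q ≠ 0 →
      Real.exp (-((Real.log (mvlen Q : ℝ) + 1) * Real.exp ((A₀ : ℝ) * ((Q.totalDegree : ℝ) + 1) ^ A₀))) ≤
        ‖MvPolynomial.aeval θ₀ Q‖)
    {i₀ i₁ : Fin n} (hne : i₀ ≠ i₁) {y₀ y₁ : ℂ} (hy₀ : cexp y₀ = θ₀ i₀) (hy₁ : cexp y₁ = θ₀ i₁)
    {W : ℕ → ℕ} (hW : Monotone W) {σ ρ : ℝ} (hσ : UltraLiouvilleSW W σ) (hσ0 : 0 < σ)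
    (hρ : TowerLiouville W ρ) (hρ0 : 0 < ρ) :
    AlgebraicIndependent ℚ
      (Fin.cons (cexp ((ρ : ℂ) * y₀)) (Fin.cons (cexp ((ρ : ℂ) * y₁))
        (Fin.cons (ρ : ℂ) (thetaS θ₀ y₀ y₁ σ))) : Fin (n + 3 + 3) → ℂ) := by
  classical
  set θ : Fin (n + 3) → ℂ := thetaS θ₀ y₀ y₁ σ with hθdef
  set j₀ : Fin (n + 3) := i₀.succ.succ.succ with hj₀
  set j₁ : Fin (n + 3) := i₁.succ.succ.succ with hj₁
  have hne' : j₀ ≠ j₁ := by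
    rw [hj₀, hj₁]; intro h
    exact hne (Fin.succ_injective _ (Fin.succ_injective _ (Fin.succ_injective _ h)))
  have hy₀' : cexp y₀ = θ j₀ := by rw [hθdef, hj₀, thetaS_succ_succ_succ, hy₀]
  have hy₁' : cexp y₁ = θ j₁ := by rw [hθdef, hj₁, thetaS_succ_succ_succ, hy₁]
  by_contra hdep
  obtain ⟨P, hP0, hP⟩ := exists_int_relation hdep
  -- (0) degrees and a fibre
  set D := P.totalDegree with hD
  have hK : ∀ s ∈ P.support, s 0 ≤ D ∧ s 1 ≤ D := fun s hs =>
    ⟨(monomial_le_degreeOf 0 hs).trans (degreeOf_le_totalDegree P 0),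
      (monomial_le_degreeOf 1 hs).trans (degreeOf_le_totalDegree P 1)⟩
  have hJ : ∀ s ∈ P.support, s 2 ≤ D := fun s hs => (monomial_le_degreeOf 2 hs).trans (degreeOf_le_totalDegree P 2)
  obtain ⟨s₀, hs₀⟩ : ∃ s₀, s₀ ∈ P.support := by
    obtain ⟨t, ht⟩ := MvPolynomial.ne_zero_iff.mp hP0
    exact ⟨t, mem_support_iff.mpr ht⟩
  set kk₀ : ℕ × ℕ := (s₀ 0, s₀ 1) with hkk₀
  set m₀ : Fin (n + 3) →₀ ℕ := sX₃ s₀ with hm₀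
  -- (0') the ρ-side (outer) sizes
  set Θ : ℝ := bigTheta θ with hΘ
  have hΘ1 : 1 ≤ Θ := one_le_bigTheta θ
  have hθΘ : ∀ i, ‖θ i‖ ≤ Θ := norm_le_bigTheta θ
  set Λ : ℝ := lam Θ y₀ y₁ (|ρ| + 2) with hΛ
  have hΛ1 : 1 ≤ Λ := one_le_lam hΘ1 y₀ y₁ (by positivity)
  set Bρ : ℕ := ⌈ρ⌉₊ + 1 with hBρ
  have hBρ1 : ρ + 1 ≤ Bρ := by rw [hBρ]; push_cast; linarith [Nat.le_ceil ρ]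
  set δe : ℕ := D + 2 * (Bρ * D) with hδe
  set LP : ℤ := mvlen P with hLP
  have hLP1 : 1 ≤ LP := one_le_mvlen hP0
  have hLP1r : (1 : ℝ) ≤ LP := by exact_mod_cast hLP1
  set Klx : ℝ := (LP : ℝ) * Λ ^ D with hKlx
  have hKlx0 : 0 ≤ Klx := by rw [hKlx]; positivity
  set cE : ℝ := 2 * ((D : ℝ) + 1) + LP + D * ((Bρ : ℝ) + 1) with hcE
  set cU : ℝ := ((D : ℝ) + 2) + cE + Θ * ((δe : ℝ) + 2) with hcU
  have hcE0 : 0 ≤ cE := by rw [hcE]; positivity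
  have hcU0 : 0 ≤ cU := by rw [hcU]; positivity
  -- (0'') the σ-side (inner) sizes and the threshold constant cT
  set Θ₀ : ℝ := bigTheta θ₀ with hΘ₀
  have hΘ₀1 : 1 ≤ Θ₀ := one_le_bigTheta θ₀
  set Λ₀ : ℝ := lam Θ₀ y₀ y₁ (|σ| + 2) with hΛ₀
  have hΛ₀1 : 1 ≤ Λ₀ := one_le_lam hΘ₀1 y₀ y₁ (by positivity)
  set Bσ : ℕ := ⌈σ⌉₊ + 1 with hBσ
  set cT : ℝ := ((A₀ : ℝ) + 19) * Θ₀ * ((Bσ : ℝ) + 1) + (1 + cE) + (δe : ℝ) * Λ₀ +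
      ((A₀ : ℝ) + 1) * ((1 + 2 * (Bσ : ℝ)) * δe + 2) with hcT
  have hcT0 : 0 ≤ cT := by rw [hcT]; positivity
  -- σ: its height mσ, the class threshold Q₀ and the size threshold Qσ
  set mσ : ℕ := 2 * (A₀ + 2) + 1 with hmσ
  obtain ⟨Q₀, hQ₀⟩ := hσ mσ
  obtain ⟨Qσ, hQσ⟩ := exists_nat_gt (1 / σ)
  obtain ⟨mρ, hmρ⟩ := exists_nat_gt (1 / ρ)
  have hexpQσ : Real.exp (-(Qσ : ℝ)) < σ := by
    have h1 : 1 / σ < Real.exp Qσ := hQσ.trans_le (by linarith [Real.add_one_le_exp (Qσ : ℝ)])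
    rw [Real.exp_neg]
    exact inv_lt_of_inv_lt₀ hσ0 (by rwa [one_div] at h1)
  have hexpmρ : Real.exp (-(mρ : ℝ)) < ρ := by
    have h1 : 1 / ρ < Real.exp mρ := hmρ.trans_le (by linarith [Real.add_one_le_exp (mρ : ℝ)])
    rw [Real.exp_neg]
    exact inv_lt_of_inv_lt₀ hρ0 (by rwa [one_div] at h1)
  -- ρ: the height m and the approximant r = p/q
  set m : ℕ := 5 + (A₀ + 2) + (D + 2) + LP.toNat + mρ + Q₀ + Qσ + (⌈cT⌉₊ + 2) + ⌈Klx + 1 + cU⌉₊ with hm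
  obtain ⟨r, hmq, hρr, hρlt⟩ := hρ m
  set q : ℕ := r.den with hqdef
  have hq : 0 < q := r.pos
  have hq1r : (1 : ℝ) ≤ q := by exact_mod_cast hq
  have hq0r : (0 : ℝ) < q := by positivity
  have hm5 : 5 ≤ m := by omega
  have hm1 : 1 ≤ m := by omega
  have hmq_r : (m : ℝ) ≤ q := by exact_mod_cast hmq
  have hqpow : (q : ℝ) ≤ (q : ℝ) ^ m := le_self_pow₀ hq1r (by omega)
  set TW : ℝ := Real.exp (((((W ⌈Real.exp (((q : ℝ)) ^ m)⌉₊ : ℕ) : ℝ)) ^ 2) ^ m) with hTW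
  have hTW0 : 0 < TW := Real.exp_pos _
  have hρsmall : |ρ - r| < Real.exp (-(m : ℝ)) := by
    refine hρlt.trans_le (Real.exp_le_exp.2 ?_)
    linarith [hmq_r, hqpow, hTW0.le]
  have hρmρ : Real.exp (-(m : ℝ)) ≤ Real.exp (-(mρ : ℝ)) :=
    Real.exp_le_exp.2 (neg_le_neg (by exact_mod_cast (show mρ ≤ m by omega)))
  have hρr_ρ : |ρ - r| < ρ := hρsmall.trans_le (hρmρ.trans hexpmρ.le)
  have hρr_1 : |ρ - r| < 1 := hρsmall.trans_le (Real.exp_le_one_iff.2 (neg_nonpos.2 (Nat.cast_nonneg m)))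
  have hr0 : (0 : ℝ) < r := by have := abs_lt.1 hρr_ρ; linarith
  have hr0' : (0 : ℚ) < r := by exact_mod_cast hr0
  set p : ℕ := r.num.natAbs with hpdef
  have hpnum : (p : ℤ) = r.num := Int.natAbs_of_nonneg (Rat.num_pos.2 hr0').le
  have hpq : Nat.Coprime p q := r.reduced
  have hr_eq : (r : ℝ) = (p : ℝ) / q := by
    rw [Rat.cast_def, hqdef]
    congr 1
    rw [← hpnum]; push_cast; rfl
  have hr_eqC : ((r : ℚ) : ℂ) = (p : ℂ) / (q : ℂ) := by
    rw [← Complex.ofReal_ratCast, hr_eq]; push_cast; rfl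
  have hρr1 : |(r : ℝ) - ρ| < 1 := by rw [abs_sub_comm]; exact hρr_1
  have hpB : p ≤ Bρ * q := by
    have h1 : (r : ℝ) < ρ + 1 := by have := abs_lt.1 hρr_1; linarith
    have h2 : (p : ℝ) / q < Bρ := by rw [← hr_eq]; linarith
    have h3 : (p : ℝ) < Bρ * q := by rwa [div_lt_iff₀ hq0r] at h2
    exact_mod_cast h3.le
  have hKq : D < q := by omega
  have hLPq : LP < (q : ℤ) := by
    have h1 : ((LP.toNat : ℕ) : ℤ) < q := by exact_mod_cast (show LP.toNat < q by omega)
    exact (Int.self_le_toNat LP).trans_lt h1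
  -- the radicals s = e^{y₀/q}, s' = e^{y₁/q} of θ_σ(j₀) = e^{y₀}, θ_σ(j₁) = e^{y₁}
  obtain ⟨s, hsdef⟩ : ∃ s : ℂ, s = cexp (y₀ / q) := ⟨_, rfl⟩
  obtain ⟨s', hs'def⟩ : ∃ s' : ℂ, s' = cexp (y₁ / q) := ⟨_, rfl⟩
  have hqC : (q : ℂ) ≠ 0 := by exact_mod_cast hq.ne'
  have hsq : s ^ q = θ j₀ := by
    rw [hsdef, ← Complex.exp_nat_mul, mul_div_cancel₀ _ hqC, hy₀']
  have hs'q : s' ^ q = θ j₁ := by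
    rw [hs'def, ← Complex.exp_nat_mul, mul_div_cancel₀ _ hqC, hy₁']
  have hsp : s ^ p = cexp (((((p : ℝ) / q : ℝ)) : ℂ) * y₀) := by
    rw [hsdef, ← Complex.exp_nat_mul]
    congr 1
    push_cast
    field_simp
  have hs'p : s' ^ p = cexp (((((p : ℝ) / q : ℝ)) : ℂ) * y₁) := by
    rw [hs'def, ← Complex.exp_nat_mul]
    congr 1
    push_cast
    field_simp
  have hrootΘ : ∀ {z : ℂ} {i : Fin (n + 3)}, z ^ q = θ i → ‖z‖ ≤ Θ := by
    intro z i hz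
    by_contra h
    push Not at h
    have h1 : 1 ≤ ‖z‖ := hΘ1.trans h.le
    have h2 : ‖z‖ ≤ ‖z‖ ^ q := le_self_pow₀ h1 (by omega)
    have h3 : ‖z‖ ^ q = ‖θ i‖ := by rw [← norm_pow, hz]
    linarith [hθΘ i]
  have hsΘ : ‖s‖ ≤ Θ := hrootΘ hsq
  have hs'Θ : ‖s'‖ ≤ Θ := hrootΘ hs'q
  -- some C_{kk'} is nonzero (ROOT AVOIDANCE §2 at den r = q > mvlen P)
  have hC : ∃ kk ∈ Finset.range (D + 1) ×ˢ Finset.range (D + 1), Cf₂ P p q D kk ≠ 0 := by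
    refine ⟨kk₀, Finset.mem_product.2 ⟨Finset.mem_range.2 (Nat.lt_succ_of_le (hK s₀ hs₀).1),
      Finset.mem_range.2 (Nat.lt_succ_of_le (hK s₀ hs₀).2)⟩, fun h0 => ?_⟩
    have hcoef : (Cf₂ P p q D kk₀).coeff m₀ =
        ∑ s ∈ P.support with ((s 0, s 1) = kk₀ ∧ sX₃ s = m₀),
          P.coeff s * (p : ℤ) ^ (s 2) * (q : ℤ) ^ (D - s 2) := by
      rw [Cf₂, coeff_sum]
      simp only [coeff_monomial]
      rw [Finset.sum_filter, Finset.sum_filter]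
      refine Finset.sum_congr rfl fun s _ => ?_
      by_cases h1 : (s 0, s 1) = kk₀ <;> by_cases h2 : sX₃ s = m₀ <;> simp [h1, h2]
    have hcast : (((Cf₂ P p q D kk₀).coeff m₀ : ℤ) : ℂ) =
        (q : ℂ) ^ D * ∑ s ∈ P.support with ((s 0, s 1) = kk₀ ∧ sX₃ s = m₀),
          ((P.coeff s : ℤ) : ℂ) * (((r : ℝ) : ℂ)) ^ (s 2) := by
      rw [hcoef, Finset.mul_sum]
      push_cast
      refine Finset.sum_congr rfl fun s hs => ?_
      have hs1 : s 2 ≤ D := hJ s (Finset.mem_filter.1 hs).1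
      rw [hr_eqC, ← pow_sub_mul_pow (q : ℂ) hs1, div_pow]
      field_simp
    have hfib := fibreSum_ne_zero P (fun s => s 2) (P.support.filter fun s => (s 0, s 1) = kk₀ ∧ sX₃ s = m₀)
      (Finset.filter_subset _ _)
      (fun s hs s' hs' h => by
        have h1 := (Finset.mem_filter.1 hs).2
        have h2 := (Finset.mem_filter.1 hs').2
        exact eq_of_parts₃ (congrArg Prod.fst (h1.1.trans h2.1.symm)) (congrArg Prod.snd (h1.1.trans h2.1.symm))
          h (h1.2.trans h2.2.symm))
      ⟨s₀, Finset.mem_filter.2 ⟨hs₀, rfl, rfl⟩⟩ r (by rw [← hqdef]; exact hLPq)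
    have : (((Cf₂ P p q D kk₀).coeff m₀ : ℤ) : ℂ) = 0 := by rw [h0, coeff_zero, Int.cast_zero]
    rw [hcast] at this
    exact (mul_ne_zero (pow_ne_zero _ hqC) hfib) this
  -- the norm form N = det M ≠ 0 of the OUTER descent (radicals of θ_σ(j₀), θ_σ(j₁))
  obtain ⟨e⟩ : Nonempty (Fin q × Fin q ≃ Fin (q * q)) := ⟨finProdFinEquiv⟩
  obtain ⟨M, hMdef⟩ : ∃ M : Matrix (Fin (q * q)) (Fin (q * q)) (MvPolynomial (Fin (n + 3)) ℤ),
      M = Matrix.reindex e e (radMat₂ (Cf₂ P p q D) D p hq j₀ j₁) := ⟨_, rfl⟩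
  have hM_apply : ∀ ρ' c', M ρ' c' = radMat₂ (Cf₂ P p q D) D p hq j₀ j₁ (e.symm ρ') (e.symm c') := by
    intro ρ' c'
    rw [hMdef, Matrix.reindex_apply, Matrix.submatrix_apply]
  obtain ⟨N, hNdef⟩ : ∃ N : MvPolynomial (Fin (n + 3)) ℤ, N = M.det := ⟨_, rfl⟩
  have hN0 : N ≠ 0 := by
    rw [hNdef, hMdef, Matrix.det_reindex_self]
    exact det_radMat₂_ne_zero j₀ j₁ q hne' (Cf₂ P p q D) hq hKq hpq hC
  obtain ⟨f, hfdef⟩ : ∃ f : MvPolynomial (Fin (n + 3)) ℤ →+* ℂ, f = (MvPolynomial.aeval θ).toRingHom :=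
    ⟨_, rfl⟩
  have hf : ∀ Q : MvPolynomial (Fin (n + 3)) ℤ, f Q = aeval θ Q := fun Q => by rw [hfdef]; rfl
  obtain ⟨Mθ, hMθ⟩ : ∃ Mθ : Matrix (Fin (q * q)) (Fin (q * q)) ℂ, Mθ = f.mapMatrix M := ⟨_, rfl⟩
  have hMθ_apply : ∀ l a', Mθ l a' = aeval θ (M l a') := fun l a' => by
    rw [hMθ, RingHom.mapMatrix_apply, Matrix.map_apply, hf]
  have hdet : Mθ.det = aeval θ N := by rw [hMθ, ← RingHom.map_det, hf, hNdef]
  set z : Fin (q * q) := e (⟨0, hq⟩, ⟨0, hq⟩) with hz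
  have hadj : ∀ a' : Fin (q * q), Mθ.adjugate z a' = aeval θ (M.adjugate z a') := by
    intro a'
    rw [hMθ, ← RingHom.map_adjugate, RingHom.mapMatrix_apply, Matrix.map_apply, hf]
  obtain ⟨E, hEdef⟩ : ∃ E : ℤ, E = ((D : ℤ) + 1) ^ 2 * (LP * ((p : ℤ) + q) ^ D) := ⟨_, rfl⟩
  have hE1 : 1 ≤ E := by
    have h1 : (1 : ℤ) ≤ ((D : ℤ) + 1) ^ 2 := one_le_pow₀ (by linarith [Int.natCast_nonneg D])
    have h2 : (1 : ℤ) ≤ ((p : ℤ) + q) ^ D :=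
      one_le_pow₀ (by linarith [Int.natCast_nonneg p, show (1:ℤ) ≤ q by exact_mod_cast hq])
    rw [hEdef]
    calc (1 : ℤ) = 1 * (1 * 1) := by ring
      _ ≤ ((D : ℤ) + 1) ^ 2 * (LP * ((p : ℤ) + q) ^ D) :=
          mul_le_mul h1 (mul_le_mul hLP1 h2 zero_le_one (by linarith)) (by norm_num) (by positivity)
  have hentry : ∀ l a', mvlen (M l a') ≤ E := fun l a' => by
    rw [hM_apply, hEdef]
    exact mvlen_radMat₂_le P p q D hq j₀ j₁ (fun kk => mvlen_Cf₂_le P p q D hJ kk)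
      (mul_nonneg (mvlen_nonneg P) (pow_nonneg (by positivity) _)) _ _
  have hentry' : ∀ l a', (M l a').totalDegree ≤ δe := fun l a' => by
    rw [hM_apply]
    exact totalDegree_radMat₂_le P p q D hq j₀ j₁ hpB _ _
  have hNlen : mvlen N ≤ ((q * q).factorial : ℤ) * E ^ (q * q) := by rw [hNdef]; exact mvlen_det_le M hentry
  have hNdeg : N.totalDegree ≤ (q * q) * δe := by rw [hNdef]; exact totalDegree_det_le M hentry'
  have hadjB : ∀ a' : Fin (q * q), mvlen (M.adjugate z a') ≤ ((q * q).factorial : ℤ) * E ^ (q * q) ∧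
      (M.adjugate z a').totalDegree ≤ (q * q) * δe := fun a' => adjugate_bounds M hE1 hentry hentry' _ _
  -- (1) eigen factorisation and the eigenvalue bound from P(e^{ρy₀}, e^{ρy₁}, ρ, θ_σ) = 0
  have hfact := det_eq_eigen_mul₂ hq D p (fun kk => aeval θ (Cf₂ P p q D kk)) (θ j₀) (θ j₁) s s' hsq hs'q e Mθ
    (by
      intro ρ' c'
      rw [hMθ_apply, hM_apply]
      simp only [radMat₂, map_sum, map_mul, map_pow, aeval_X])
  have heigen : ∑ kk ∈ Finset.range (D + 1) ×ˢ Finset.range (D + 1),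
      aeval θ (Cf₂ P p q D kk) * (s ^ (p * kk.1) * s' ^ (p * kk.2)) =
      (q : ℂ) ^ D * Frel₂ P θ y₀ y₁ ((p : ℝ) / q) :=
    eigen_eq_Frel₂ P p q D θ y₀ y₁ hK hJ hq s s' hsp hs'p
  have hrel : Frel₂ P θ y₀ y₁ ρ = 0 := by rw [Frel₂_eq_aeval]; exact hP
  have hΦ : ‖∑ kk ∈ Finset.range (D + 1) ×ˢ Finset.range (D + 1),
      aeval θ (Cf₂ P p q D kk) * (s ^ (p * kk.1) * s' ^ (p * kk.2))‖ ≤ (q : ℝ) ^ D * (Klx * |(r : ℝ) - ρ|) := by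
    rw [heigen, norm_mul, norm_pow, Complex.norm_natCast]
    refine mul_le_mul_of_nonneg_left ?_ (by positivity)
    have hLip := lipschitz_Frel₂_explicit P hΘ1 hθΘ y₀ y₁ ρ (x := (p : ℝ) / q) (by rw [← hr_eq]; exact hρr1)
    rw [hrel, sub_zero, ← hr_eq] at hLip
    rw [← hr_eq]
    rw [hKlx]
    exact hLip
  have hw : ∀ a' : Fin (q * q), ‖s ^ ((e.symm a').1 : ℕ) * s' ^ ((e.symm a').2 : ℕ)‖ ≤ Θ ^ q * Θ ^ q := by
    intro a'
    rw [norm_mul, norm_pow, norm_pow]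
    exact mul_le_mul
      ((pow_le_pow_left₀ (norm_nonneg _) hsΘ _).trans (pow_le_pow_right₀ hΘ1 (e.symm a').1.isLt.le))
      ((pow_le_pow_left₀ (norm_nonneg _) hs'Θ _).trans (pow_le_pow_right₀ hΘ1 (e.symm a').2.isLt.le))
      (by positivity) (by positivity)
  -- (2) UPPER BOUND over the transcendental base
  have hup : ‖aeval θ N‖ ≤ (Klx + 1) * Real.exp (cU * ((q : ℝ) ^ 2) ^ 2) * |(r : ℝ) - ρ| :=
    norm_normForm_le hq hdet hadj hE1 hadjB hΘ1 hθΘ hw hfact hKlx0 (abs_nonneg _) hΦ hLP1 hpB hEdef hcE hcU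
  -- (3) the norm form's length and degree, and thrP(N) ≤ exp(cT q⁴)
  have hNlenR : (mvlen N : ℝ) ≤ Real.exp ((1 + cE) * ((q : ℝ) ^ 2) ^ 2) :=
    normForm_len_le hq hE1 hNlen hLP1 hpB hEdef hcE
  have hq4 : (1 : ℝ) ≤ ((q : ℝ) ^ 2) ^ 2 := one_le_pow₀ (one_le_pow₀ hq1r)
  have hQcast : ((q * q : ℕ) : ℝ) = (q : ℝ) ^ 2 := by push_cast; ring
  have hDN : (N.totalDegree : ℝ) ≤ ((q : ℝ) ^ 2) ^ 2 * δe := by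
    have h1 : (N.totalDegree : ℝ) ≤ ((q * q : ℕ) : ℝ) * δe := by exact_mod_cast hNdeg
    rw [hQcast] at h1
    refine h1.trans (mul_le_mul_of_nonneg_right ?_ (Nat.cast_nonneg _))
    nlinarith [one_le_pow₀ (n := 2) hq1r]
  have hthrN : thrP A₀ θ₀ y₀ y₁ σ N ≤ Real.exp (cT * ((q : ℝ) ^ 2) ^ 2) :=
    thr_le_exp_quartic A₀ hΘ₀1 hΛ₀1 Bσ (one_le_mvlen hN0) hq4 hNlenR hDN hcT
  have hthrN0 : 0 ≤ thrP A₀ θ₀ y₀ y₁ σ N :=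
    thr_nonneg A₀ (by linarith) (by linarith) _ _ (mvlen_nonneg N)
  -- (4) the σ-scale: the window [Q, W Q] and the approximant r_σ from the short waits
  set Q : ℕ := Q₀ + Qσ + ⌈thrP A₀ θ₀ y₀ y₁ σ N⌉₊ with hQ
  obtain ⟨rσ, hQden, hdenW, hσne, hσlt⟩ := hQ₀ Q (by omega)
  have hden : thrP A₀ θ₀ y₀ y₁ σ N ≤ rσ.den :=
    (Nat.le_ceil _).trans (by exact_mod_cast (show ⌈thrP A₀ θ₀ y₀ y₁ σ N⌉₊ ≤ rσ.den by omega))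
  have hdσ1 : (1 : ℝ) ≤ rσ.den := by exact_mod_cast rσ.pos
  have hdσQσ : (Qσ : ℝ) ≤ rσ.den := by exact_mod_cast (show Qσ ≤ rσ.den by omega)
  have hσsmall : Real.exp (-Real.exp ((rσ.den : ℝ) ^ mσ)) ≤ Real.exp (-(Qσ : ℝ)) := by
    refine Real.exp_le_exp.2 (neg_le_neg (hdσQσ.trans ?_))
    have h1 : (rσ.den : ℝ) ≤ (rσ.den : ℝ) ^ mσ := le_self_pow₀ hdσ1 (show mσ ≠ 0 by omega)
    linarith [Real.add_one_le_exp ((rσ.den : ℝ) ^ mσ)]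
  have hrσσ : |σ - rσ| < σ := hσlt.trans_le (hσsmall.trans hexpQσ.le)
  have hrσ1 : |σ - rσ| < 1 := hσlt.trans_le (Real.exp_le_one_iff.2 (neg_nonpos.2 (Real.exp_pos _).le))
  have hrate : |σ - rσ| < Real.exp (-Real.exp ((rσ.den : ℝ) ^ (2 * (A₀ + 2)))) := by
    refine hσlt.trans_le (Real.exp_le_exp.2 (neg_le_neg (Real.exp_le_exp.2 ?_)))
    exact pow_le_pow_right₀ hdσ1 (by omega)
  -- (5) LOWER BOUND from the quantitative storey-one cell at N
  have hlow := twoRadical_lower hA₀ hne hy₀ hy₁ hσ0 N hN0 rσ hden hrσσ hrσ1 hrate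
  rw [← aeval_thetaS, ← hθdef] at hlow
  -- (6) Q ≤ Q' := ⌈exp(q^m)⌉ and the W-comparison
  set Q' : ℕ := ⌈Real.exp (((q : ℝ)) ^ m)⌉₊ with hQ'
  have hq5m : (q : ℝ) ^ 5 ≤ (q : ℝ) ^ m := pow_le_pow_right₀ hq1r hm5
  have hqX4 : (q : ℝ) ≤ ((q : ℝ) ^ 2) ^ 2 := by
    have h1 : (q : ℝ) ≤ (q : ℝ) ^ 2 := by nlinarith only [hq1r]
    have h2 : (q : ℝ) ^ 2 ≤ ((q : ℝ) ^ 2) ^ 2 := by nlinarith only [h1, hq1r]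
    exact h1.trans h2
  have hq45 : ∀ {c : ℝ}, c ≤ q → c * ((q : ℝ) ^ 2) ^ 2 ≤ (q : ℝ) ^ m := fun {c} hc =>
    calc c * ((q : ℝ) ^ 2) ^ 2 ≤ (q : ℝ) * ((q : ℝ) ^ 2) ^ 2 := mul_le_mul_of_nonneg_right hc (by positivity)
      _ = (q : ℝ) ^ 5 := by ring
      _ ≤ (q : ℝ) ^ m := hq5m
  have hQQ' : Q ≤ Q' := by
    have hcTq : cT + 2 ≤ q := by
      have h1 : ((⌈cT⌉₊ + 2 : ℕ) : ℝ) ≤ q := by exact_mod_cast (show ⌈cT⌉₊ + 2 ≤ q by omega)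
      push_cast at h1
      linarith [Nat.le_ceil cT]
    have hQr : (Q : ℝ) ≤ Real.exp (((q : ℝ)) ^ m) := by
      have h1 : (Q : ℝ) ≤ (q : ℝ) + 1 + thrP A₀ θ₀ y₀ y₁ σ N := by
        rw [hQ]; push_cast
        have h2 : ((Q₀ + Qσ : ℕ) : ℝ) ≤ q := by exact_mod_cast (show Q₀ + Qσ ≤ q by omega)
        push_cast at h2
        linarith [(Nat.ceil_lt_add_one hthrN0).le]
      have h3 : (q : ℝ) + 1 + thrP A₀ θ₀ y₀ y₁ σ N ≤ Real.exp (((q : ℝ) + 1) + cT * ((q : ℝ) ^ 2) ^ 2) := by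
        have h3a : (q : ℝ) + 1 + thrP A₀ θ₀ y₀ y₁ σ N ≤ ((q : ℝ) + 1) + Real.exp (cT * ((q : ℝ) ^ 2) ^ 2) := by
          linarith [hthrN]
        exact h3a.trans (add_exp_le_exp_add (by positivity) (by positivity))
      refine h1.trans (h3.trans (Real.exp_le_exp.2 ?_))
      have h4 : (q : ℝ) + 1 ≤ 2 * ((q : ℝ) ^ 2) ^ 2 := by linarith [hqX4, hq4]
      have h5 : cT * ((q : ℝ) ^ 2) ^ 2 + 2 * ((q : ℝ) ^ 2) ^ 2 ≤ (q : ℝ) ^ m := by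
        have := hq45 hcTq
        linarith [this, show (cT + 2) * ((q : ℝ) ^ 2) ^ 2 = cT * ((q : ℝ) ^ 2) ^ 2 + 2 * ((q : ℝ) ^ 2) ^ 2 by ring]
      linarith [h4, h5]
    calc Q = ⌈((Q : ℕ) : ℝ)⌉₊ := (Nat.ceil_natCast Q).symm
      _ ≤ Q' := Nat.ceil_mono hQr
  have hWW : (rσ.den : ℝ) ≤ (W Q' : ℝ) := by exact_mod_cast hdenW.trans (hW hQQ')
  have hW1 : (1 : ℝ) ≤ (W Q' : ℝ) := hdσ1.trans hWW
  have htower : Real.exp (-TW) ≤ Real.exp (-Real.exp ((((rσ.den : ℕ) : ℝ) ^ 2) ^ (A₀ + 2))) := by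
    rw [hTW, Real.exp_le_exp, neg_le_neg_iff, Real.exp_le_exp]
    calc (((rσ.den : ℕ) : ℝ) ^ 2) ^ (A₀ + 2) ≤ ((W Q' : ℝ) ^ 2) ^ (A₀ + 2) :=
          pow_le_pow_left₀ (by positivity) (pow_le_pow_left₀ (by positivity) hWW 2) _
      _ ≤ ((W Q' : ℝ) ^ 2) ^ m := pow_le_pow_right₀ (one_le_pow₀ hW1) (by omega)
  -- (7) the clash
  have hfin1 : (Klx + 1) * Real.exp (cU * ((q : ℝ) ^ 2) ^ 2) * Real.exp (-((q : ℝ) ^ m)) ≤ 1 := by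
    have hKq' : Klx + 1 + cU ≤ q := by
      have h1 : ((⌈Klx + 1 + cU⌉₊ : ℕ) : ℝ) ≤ q := by exact_mod_cast (show ⌈Klx + 1 + cU⌉₊ ≤ q by omega)
      linarith [Nat.le_ceil (Klx + 1 + cU)]
    have h2 : Klx + 1 ≤ Real.exp (Klx + 1) := by linarith [Real.add_one_le_exp (Klx + 1)]
    have h3 : (Klx + 1) + cU * ((q : ℝ) ^ 2) ^ 2 ≤ (q : ℝ) ^ m := by
      have h4 := hq45 hKq'
      have h5 : Klx + 1 ≤ (Klx + 1) * ((q : ℝ) ^ 2) ^ 2 := le_mul_of_one_le_right (by positivity) hq4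
      linarith [h4, h5, show (Klx + 1 + cU) * ((q : ℝ) ^ 2) ^ 2 =
        (Klx + 1) * ((q : ℝ) ^ 2) ^ 2 + cU * ((q : ℝ) ^ 2) ^ 2 by ring]
    calc (Klx + 1) * Real.exp (cU * ((q : ℝ) ^ 2) ^ 2) * Real.exp (-((q : ℝ) ^ m))
        ≤ Real.exp (Klx + 1) * Real.exp (cU * ((q : ℝ) ^ 2) ^ 2) * Real.exp (-((q : ℝ) ^ m)) := by
          gcongr
      _ = Real.exp ((Klx + 1) + cU * ((q : ℝ) ^ 2) ^ 2 - (q : ℝ) ^ m) := by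
          rw [← Real.exp_add, ← Real.exp_add]; ring_nf
      _ ≤ Real.exp 0 := Real.exp_le_exp.2 (by linarith)
      _ = 1 := Real.exp_zero
  have hlt : ‖aeval θ N‖ < Real.exp (-TW) := by
    have hpos : 0 < (Klx + 1) * Real.exp (cU * ((q : ℝ) ^ 2) ^ 2) := by positivity
    have hρlt' : |(r : ℝ) - ρ| < Real.exp (-(((q : ℝ)) ^ m + TW)) := by rw [abs_sub_comm]; exact hρlt
    calc ‖aeval θ N‖ ≤ (Klx + 1) * Real.exp (cU * ((q : ℝ) ^ 2) ^ 2) * |(r : ℝ) - ρ| := hup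
      _ < (Klx + 1) * Real.exp (cU * ((q : ℝ) ^ 2) ^ 2) * Real.exp (-(((q : ℝ)) ^ m + TW)) :=
          mul_lt_mul_of_pos_left hρlt' hpos
      _ = ((Klx + 1) * Real.exp (cU * ((q : ℝ) ^ 2) ^ 2) * Real.exp (-((q : ℝ) ^ m))) * Real.exp (-TW) := by
          rw [neg_add, Real.exp_add]; ring
      _ ≤ 1 * Real.exp (-TW) := mul_le_mul_of_nonneg_right hfin1 (Real.exp_pos _).le
      _ = Real.exp (-TW) := one_mul _
  linarith [htower, hlow, hlt]

end Product

end Summit.Schanuel.Schanuel.Theorems.RootDecomp1BProductCell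

end
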